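import Mathlib

/-!
# Escape from a nondegenerate potential maximum is no faster than `cosh`: a comparison lemma

Topic `Literature/Analysis/ODE` (namespace `Literature.Analysis.ODE`). Everything is proved; no
definitions.

A classical particle released AT REST at distance `ρ′` from a nondegenerate maximum `xc` of a
potential (here: the rays of `u_tt − u_xx + μ²q(x)u` at fixed frequency, `X′ = ξ/ω₀`,
`ξ′ = −q′(X)/(2ω₀)`, `ξ(0) = 0`) rolls away from the maximum, but SLOWLY: as long as the restoring
force is at most linear, `−q′(x) ≤ K(x − xc)` on `[xc, xc + D]`, one has

  `X(t) − xc ≤ ρ′ cosh(λt)`,  `λ² = K/(2ω₀²)`,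

on every interval `[0, T]` with `ρ′cosh(λT) ≤ D` (`trajectory_sub_le_cosh`). In particular the
exit time from the `D`-neighbourhood is at least `λ⁻¹ log(D/ρ′)` — the logarithmic divergence of the
sojourn time near a hyperbolic fixed point (for the Schwarzschild photon sphere: the Lyapunov time
`3√3 M` per e-fold). Ingredients: the particle moves monotonically away from `xc`
(`trajectory_monotone`, a real-induction argument: `ξ ≥ 0` and `X ≥ X₀` propagate to the right),
and the linear comparison `Z″ ≥ λ²Z, Z(0) = Z′(0) = 0 ⇒ Z ≥ 0` (`nonneg_of_deriv_deriv_ge`,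
through `u = Z′ + λZ`, `(e^{−λt}u)′ ≥ 0`, `(e^{λt}Z)′ = e^{λt}u ≥ 0`), again propagated by real
induction (`IsClosed.Icc_subset_of_forall_mem_nhdsWithin`). Folklore (e.g. the Hartman–Grobman
picture; here with explicit constants and no linearisation theorem).

## References

* P. Hartman, *Ordinary Differential Equations*, SIAM Classics 38 (2002), Ch. III §4 (differential
  inequalities) and Ch. IX (behaviour near a saddle). Key `Hartman2002`. [folklore]
-/

noncomputable section

namespace Literature.Analysis.ODE

open Set Filter Topology

/-! ### The linear comparison `Z″ ≥ λ² Z` -/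

/-- **`Z″ ≥ λ²Z` with `Z(0) = Z′(0) = 0` forces `Z ≥ 0` on `[0, T]`.** [folklore] -/
theorem nonneg_of_deriv_deriv_ge {Z : ℝ → ℝ} {lam T : ℝ} (hZ : ContDiff ℝ 2 Z)
    (h0 : Z 0 = 0) (h0' : deriv Z 0 = 0)
    (hineq : ∀ t ∈ Icc 0 T, lam ^ 2 * Z t ≤ deriv (deriv Z) t) :
    ∀ t ∈ Icc 0 T, 0 ≤ Z t := by
  have hZ1 : ContDiff ℝ 1 Z := hZ.of_le (by norm_num)
  have hdZ1 : ContDiff ℝ 1 (deriv Z) := hZ.deriv'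
  have hZ' : ∀ t, HasDerivAt Z (deriv Z t) t := fun t => (hZ1.differentiable one_ne_zero t).hasDerivAt
  have hZ'' : ∀ t, HasDerivAt (deriv Z) (deriv (deriv Z) t) t := fun t =>
    (hdZ1.differentiable one_ne_zero t).hasDerivAt
  -- `u = Z′ + λZ`, `g = e^{−λt} u` is non-decreasing on `[0, T]`
  set u : ℝ → ℝ := fun t => deriv Z t + lam * Z t with hu
  have hu' : ∀ t, HasDerivAt u (deriv (deriv Z) t + lam * deriv Z t) t := fun t =>
    (hZ'' t).add ((hZ' t).const_mul lam)
  set g : ℝ → ℝ := fun t => Real.exp (-(lam * t)) * u t with hg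
  have hg' : ∀ t, HasDerivAt g (Real.exp (-(lam * t)) * (deriv (deriv Z) t + lam * deriv Z t
      - lam * u t)) t := by
    intro t
    have he : HasDerivAt (fun t => Real.exp (-(lam * t))) (Real.exp (-(lam * t)) * -lam) t := by
      simpa using (((hasDerivAt_id t).const_mul lam).neg).exp
    have h := he.mul (hu' t)
    refine h.congr_deriv ?_
    simp only [hu]; ring
  have hgmono : MonotoneOn g (Icc 0 T) := by
    refine monotoneOn_of_deriv_nonneg (convex_Icc 0 T)
      (fun t _ => (hg' t).continuousAt.continuousWithinAt)
      (fun t _ => (hg' t).differentiableAt.differentiableWithinAt) ?_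
    intro t ht
    rw [interior_Icc] at ht
    rw [(hg' t).deriv]
    refine mul_nonneg (Real.exp_pos _).le ?_
    have h := hineq t (Ioo_subset_Icc_self ht)
    simp only [hu]
    nlinarith [h]
  have hu0 : u 0 = 0 := by simp [hu, h0, h0']
  have hunonneg : ∀ t ∈ Icc 0 T, 0 ≤ u t := by
    intro t ht
    have h := hgmono (left_mem_Icc.2 (ht.1.trans ht.2)) ht ht.1
    simp only [hg, mul_zero, neg_zero, Real.exp_zero, hu0] at h
    exact (mul_nonneg_iff_of_pos_left (Real.exp_pos _)).1 h
  -- `k = e^{λt} Z` is non-decreasing on `[0, T]`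
  set k : ℝ → ℝ := fun t => Real.exp (lam * t) * Z t with hk
  have hk' : ∀ t, HasDerivAt k (Real.exp (lam * t) * u t) t := by
    intro t
    have he : HasDerivAt (fun t => Real.exp (lam * t)) (Real.exp (lam * t) * lam) t := by
      simpa using ((hasDerivAt_id t).const_mul lam).exp
    have h := he.mul (hZ' t)
    refine h.congr_deriv ?_
    simp only [hu]; ring
  have hkmono : MonotoneOn k (Icc 0 T) := by
    refine monotoneOn_of_deriv_nonneg (convex_Icc 0 T)
      (fun t _ => (hk' t).continuousAt.continuousWithinAt)
      (fun t _ => (hk' t).differentiableAt.differentiableWithinAt) ?_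
    intro t ht
    rw [interior_Icc] at ht
    rw [(hk' t).deriv]
    exact mul_nonneg (Real.exp_pos _).le (hunonneg t (Ioo_subset_Icc_self ht))
  intro t ht
  have h := hkmono (left_mem_Icc.2 (ht.1.trans ht.2)) ht ht.1
  simp only [hk, mul_zero, Real.exp_zero, h0] at h
  exact (mul_nonneg_iff_of_pos_left (Real.exp_pos _)).1 h

/-! ### The particle rolls away monotonically -/

/-- **Monotone escape.** For `X′ = ξ/ω₀`, `ξ′ = −q′(X)/(2ω₀)` with `ξ(0) = 0`, `X(0) = X₀ > xc` and
`q′ ≤ 0` on `[xc, ∞)`: `ξ ≥ 0` and `X ≥ X₀` for all `t ≥ 0`. [folklore] -/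
theorem trajectory_monotone {q X ξ : ℝ → ℝ} {ω₀ xc X₀ : ℝ} (hω₀ : 0 < ω₀)
    (hX : ∀ t, HasDerivAt X (ξ t / ω₀) t) (hξ : ∀ t, HasDerivAt ξ (-(deriv q (X t)) / (2 * ω₀)) t)
    (hq' : ∀ x, xc ≤ x → deriv q x ≤ 0) (hX0 : X 0 = X₀) (hξ0 : ξ 0 = 0) (hxc : xc < X₀) :
    ∀ t, 0 ≤ t → 0 ≤ ξ t ∧ X₀ ≤ X t := by
  have hXc : Continuous X := continuous_iff_continuousAt.2 fun t => (hX t).continuousAt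
  have hξc : Continuous ξ := continuous_iff_continuousAt.2 fun t => (hξ t).continuousAt
  set s : Set ℝ := {t | 0 ≤ ξ t ∧ X₀ ≤ X t} with hs
  have hsc : IsClosed s :=
    (isClosed_le continuous_const hξc).inter (isClosed_le continuous_const hXc)
  have h0s : (0 : ℝ) ∈ s := ⟨by simp [hξ0], by simp [hX0]⟩
  -- propagation to the right
  have hstep : ∀ T : ℝ, ∀ t ∈ s ∩ Ico 0 T, s ∈ 𝓝[>] t := by
    intro T t ht
    obtain ⟨⟨hξt, hXt⟩, ht0, htT⟩ := ht
    -- `X > xc` on `[t, t + ε]`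
    have hopen : IsOpen {u : ℝ | xc < X u} := isOpen_lt continuous_const hXc
    obtain ⟨ε, hε, hball⟩ := Metric.isOpen_iff.1 hopen t (by show xc < X t; linarith)
    have hgt : ∀ u ∈ Icc t (t + ε / 2), xc < X u := fun u hu =>
      hball (by rw [Metric.mem_ball, Real.dist_eq, abs_lt]; constructor <;> linarith [hu.1, hu.2])
    -- `ξ` is non-decreasing there, hence `≥ ξ t ≥ 0`
    have hξmono : MonotoneOn ξ (Icc t (t + ε / 2)) := by
      refine monotoneOn_of_deriv_nonneg (convex_Icc _ _)
        (fun u _ => (hξ u).continuousAt.continuousWithinAt)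
        (fun u _ => (hξ u).differentiableAt.differentiableWithinAt) ?_
      intro u hu
      rw [interior_Icc] at hu
      rw [(hξ u).deriv]
      have := hq' (X u) (hgt u (Ioo_subset_Icc_self hu)).le
      exact div_nonneg (by linarith) (by positivity)
    have hξnn : ∀ u ∈ Icc t (t + ε / 2), 0 ≤ ξ u := fun u hu =>
      hξt.trans (hξmono (left_mem_Icc.2 (by linarith)) hu hu.1)
    have hXmono : MonotoneOn X (Icc t (t + ε / 2)) := by
      refine monotoneOn_of_deriv_nonneg (convex_Icc _ _)
        (fun u _ => (hX u).continuousAt.continuousWithinAt)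
        (fun u _ => (hX u).differentiableAt.differentiableWithinAt) ?_
      intro u hu
      rw [interior_Icc] at hu
      rw [(hX u).deriv]
      exact div_nonneg (hξnn u (Ioo_subset_Icc_self hu)) hω₀.le
    have hsub : Icc t (t + ε / 2) ⊆ s := fun u hu =>
      ⟨hξnn u hu, hXt.trans (hXmono (left_mem_Icc.2 (by linarith)) hu hu.1)⟩
    exact mem_of_superset (Icc_mem_nhdsGT (by linarith)) hsub
  intro t ht
  have h := (hsc.inter isClosed_Icc).Icc_subset_of_forall_mem_nhdsWithin h0s (hstep t)
    ⟨ht, le_rfl⟩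
  exact h

/-! ### The `cosh` bound -/

/-- **Escape is no faster than `cosh`.** In the setting of `trajectory_monotone`, assume moreover
`X ∈ C²`, `−q′(x) ≤ 2ω₀²λ²(x − xc)` on `[xc, xc + D]` (`λ > 0`) and `ρ′cosh(λT) ≤ D`,
`ρ′ = X₀ − xc`. Then `X(t) − xc ≤ ρ′cosh(λt)` for all `t ∈ [0, T]`. [folklore] -/
theorem trajectory_sub_le_cosh {q X ξ : ℝ → ℝ} {ω₀ xc X₀ lam D T : ℝ} (hω₀ : 0 < ω₀)
    (hlam : 0 < lam) (hX2 : ContDiff ℝ 2 X)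
    (hX : ∀ t, HasDerivAt X (ξ t / ω₀) t) (hξ : ∀ t, HasDerivAt ξ (-(deriv q (X t)) / (2 * ω₀)) t)
    (hq' : ∀ x, xc ≤ x → deriv q x ≤ 0) (hX0 : X 0 = X₀) (hξ0 : ξ 0 = 0) (hxc : xc < X₀)
    (hK : ∀ x ∈ Icc xc (xc + D), -(deriv q x) ≤ 2 * ω₀ ^ 2 * lam ^ 2 * (x - xc))
    (hT : (X₀ - xc) * Real.cosh (lam * T) ≤ D) :
    ∀ t ∈ Icc 0 T, X t - xc ≤ (X₀ - xc) * Real.cosh (lam * t) := by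
  have hXc : Continuous X := continuous_iff_continuousAt.2 fun t => (hX t).continuousAt
  have hmono := trajectory_monotone hω₀ hX hξ hq' hX0 hξ0 hxc
  have hρ : 0 < X₀ - xc := by linarith
  -- second derivative of `X`
  have hdX : ∀ t, deriv X t = ξ t / ω₀ := fun t => (hX t).deriv
  have hddX : ∀ t, HasDerivAt (deriv X) (-(deriv q (X t)) / (2 * ω₀) / ω₀) t := by
    intro t
    rw [show deriv X = fun t => ξ t / ω₀ from funext hdX]
    exact (hξ t).div_const ω₀
  -- the comparison function `Z = ρ′cosh(λ·) − (X − xc)`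
  set Z : ℝ → ℝ := fun t => (X₀ - xc) * Real.cosh (lam * t) - (X t - xc) with hZ
  have hcosh : ∀ t, HasDerivAt (fun t => (X₀ - xc) * Real.cosh (lam * t))
      ((X₀ - xc) * (Real.sinh (lam * t) * lam)) t := fun t =>
    ((Real.hasDerivAt_cosh (lam * t)).comp t ((hasDerivAt_id t).const_mul lam |>.congr_deriv
      (by simp))).const_mul _
  have hsinh : ∀ t, HasDerivAt (fun t => (X₀ - xc) * (Real.sinh (lam * t) * lam))
      ((X₀ - xc) * (Real.cosh (lam * t) * lam * lam)) t := fun t =>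
    (((Real.hasDerivAt_sinh (lam * t)).comp t ((hasDerivAt_id t).const_mul lam |>.congr_deriv
      (by simp))).mul_const lam).const_mul _
  have hZ' : ∀ t, HasDerivAt Z ((X₀ - xc) * (Real.sinh (lam * t) * lam) - ξ t / ω₀) t := fun t =>
    (hcosh t).sub ((hX t).sub_const xc)
  have hdZ : deriv Z = fun t => (X₀ - xc) * (Real.sinh (lam * t) * lam) - ξ t / ω₀ :=
    funext fun t => (hZ' t).deriv
  have hZ'' : ∀ t, HasDerivAt (deriv Z) ((X₀ - xc) * (Real.cosh (lam * t) * lam * lam)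
      - -(deriv q (X t)) / (2 * ω₀) / ω₀) t := fun t => by
    rw [hdZ]; exact (hsinh t).sub ((hξ t).div_const ω₀)
  have hZC2 : ContDiff ℝ 2 Z := by
    have hc : ContDiff ℝ 2 fun t => (X₀ - xc) * Real.cosh (lam * t) :=
      contDiff_const.mul (Real.contDiff_cosh.comp (contDiff_const.mul contDiff_id))
    exact hc.sub (hX2.sub contDiff_const)
  have hZ0 : Z 0 = 0 := by simp [hZ, hX0]
  have hZ0' : deriv Z 0 = 0 := by rw [hdZ]; simp [hξ0]
  -- real induction on the closed set where the bound holds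
  set s : Set ℝ := {t | X t - xc ≤ (X₀ - xc) * Real.cosh (lam * t)} with hs
  have hsc : IsClosed s := isClosed_le (hXc.sub continuous_const)
    (continuous_const.mul (Real.continuous_cosh.comp (continuous_const.mul continuous_id)))
  have h0s : (0 : ℝ) ∈ s := by show X 0 - xc ≤ (X₀ - xc) * Real.cosh (lam * 0); simp [hX0]
  have hstep : ∀ t ∈ s ∩ Ico 0 T, s ∈ 𝓝[>] t := by
    intro t ht
    obtain ⟨hts, ht0, htT⟩ := ht
    -- strictly inside the `D`-neighbourhood at time `t`
    have hlt : (X₀ - xc) * Real.cosh (lam * t) < D := by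
      have hc : Real.cosh (lam * t) < Real.cosh (lam * T) := by
        rw [Real.cosh_lt_cosh, abs_of_nonneg (by positivity), abs_of_nonneg]
        · exact mul_lt_mul_of_pos_left htT hlam
        · exact (mul_nonneg hlam.le (ht0.trans htT.le))
      exact lt_of_lt_of_le (mul_lt_mul_of_pos_left hc hρ) hT
    have hXt : X t < xc + D := by have := hts; simp only [hs, mem_setOf_eq] at this; linarith
    -- hence on `[t, t + ε]` (continuity) and on `[0, t]` (monotonicity)
    have hopen : IsOpen {u : ℝ | X u < xc + D} := isOpen_lt hXc continuous_const
    obtain ⟨ε, hε, hball⟩ := Metric.isOpen_iff.1 hopen t hXt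
    set ε' : ℝ := min (ε / 2) (T - t) with hε'
    have hε'0 : 0 < ε' := lt_min (by linarith) (by linarith)
    have hε'T : t + ε' ≤ T := by have := min_le_right (ε / 2) (T - t); linarith
    have hXmonoR : MonotoneOn X (Ici 0) := by
      refine monotoneOn_of_deriv_nonneg (convex_Ici 0)
        (fun u _ => (hX u).continuousAt.continuousWithinAt)
        (fun u _ => (hX u).differentiableAt.differentiableWithinAt) ?_
      intro u hu
      rw [interior_Ici] at hu
      rw [(hX u).deriv]
      exact div_nonneg (hmono u hu.le).1 hω₀.le
    have hin : ∀ u ∈ Icc 0 (t + ε'), X u ∈ Icc xc (xc + D) := by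
      intro u hu
      refine ⟨by linarith [(hmono u hu.1).2], ?_⟩
      rcases le_or_gt u t with hut | hut
      · exact ((hXmonoR hu.1 ht0 hut).trans_lt hXt).le
      · refine (hball ?_).le
        rw [Metric.mem_ball, Real.dist_eq, abs_lt]
        have := min_le_left (ε / 2) (T - t)
        constructor <;> linarith [hu.2]
    -- the differential inequality on `[0, t + ε']`, hence `Z ≥ 0` there
    have hineq : ∀ u ∈ Icc 0 (t + ε'), lam ^ 2 * Z u ≤ deriv (deriv Z) u := by
      intro u hu
      rw [(hZ'' u).deriv]
      have hk := hK (X u) (hin u hu)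
      simp only [hZ]
      have e : -(deriv q (X u)) / (2 * ω₀) / ω₀ = -(deriv q (X u)) / (2 * ω₀ ^ 2) := by
        field_simp
      rw [e]
      have h2 : -(deriv q (X u)) / (2 * ω₀ ^ 2) ≤ lam ^ 2 * (X u - xc) := by
        rw [div_le_iff₀ (by positivity)]; nlinarith [hk]
      nlinarith [h2, Real.cosh_pos (lam * u)]
    have hZnn := nonneg_of_deriv_deriv_ge hZC2 hZ0 hZ0' hineq
    have hsub : Icc t (t + ε') ⊆ s := by
      intro u hu
      have h := hZnn u ⟨ht0.trans hu.1, hu.2⟩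
      simp only [hZ] at h
      show X u - xc ≤ (X₀ - xc) * Real.cosh (lam * u)
      linarith
    exact mem_of_superset (Icc_mem_nhdsGT (by linarith)) hsub
  intro t ht
  exact (hsc.inter isClosed_Icc).Icc_subset_of_forall_mem_nhdsWithin h0s hstep ht

end Literature.Analysis.ODE
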